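import Summits.Ventures.ResidMod.TateFrames
import Literature.NumberTheory.DiophantineGeometry.AVTorsionCharpolyReductionProofs
import Mathlib.RingTheory.Flat.Basic
import HarnessLib

/-!
# Venture ResidMod — UNRAM2 kernel link: a good Euler factor at `p` makes the mod-`ℓ` torsion
# representation `A[ℓ]` (`ℓ ≠ p`) unramified at `p`

HONEST FRAMING. Theorems only (no fact, no definition, no claim about any surface); plumbing for the
cell `pub-residmod`. It discharges the slot UNRAM2(3) of the T-L certificate ("`ρ̄_{A,3}|_{G_{ℚ₂}}` is
unramified", BCGP 2025 Thm. 1.1.1 (2), first half) from the Euler-factor predicate the engines certify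
at `2`: `A.HasGoodEulerFactorAt 2 L₂` says every frame of `V₃(A)` is unramified at `v ∣ 2`
([BPPTVY (4.1.5)]); an element acting trivially on `V₃(A) = ℚ₃ ⊗ T₃(A)` acts trivially on `T₃(A)`
(`T₃(A)` is `ℤ₃`-free — tree theorem `module_free_tateModule_holds` — so `x ↦ 1 ⊗ x` is injective) and
hence on `A[3] = T₃(A)/3` (the first projection `T₃(A) → A[3]` is onto — tree theorem
`proj_surjective_of_card`, from `#A[3ⁿ] = 3^{4n}`, `natCard_geomTorsion_pow'`), so every torsion frame
matrix of an inertia element is the identity.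

* `smul_eq_self_of_rationalTateRep_eq_one` — `ρ_{A,ℓ}(g) = 1` on `V_ℓ(A)` ⟹ `g • P = P` for every
  `P ∈ A[ℓ](ℚ̄)`.
* `torsionRep_isUnramifiedAt_of_hasGoodEulerFactorAt` — for an abelian surface, a good Euler factor at
  `p` and a framed `ρb : Γ_ℚ → GL₄(𝔽_ℓ)` (`ℓ ≠ p`) carrying a contragredient torsion frame of `A[ℓ]`
  (slot TORS3) ⟹ `ρb` is unramified at every `v ∣ p` — VERBATIM the slot `hunr` of
  `modular_of_mod3Row` at `p = 2`, `ℓ = 3`.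

References: [SerreTate1968] §1 (`T_ℓ/ℓ = A[ℓ]`, criterion of Néron–Ogg–Shafarevich); [BrumerEtAl2019]
(4.1.5); [BoxerCalegariGeePilloni2025] Thm. 1.1.1 (2).
-/

noncomputable section

namespace Summit.Ventures.ResidMod

open Field IsDedekindDomain
open scoped NumberField TensorProduct AddSubgroup
open Literature.NumberTheory.GaloisRepresentations Literature.NumberTheory.Automorphic.Paramodular
open Literature.NumberTheory.EllipticCurves Literature.NumberTheory.EllipticCurves.TateModule
open Literature.NumberTheory.DiophantineGeometry
open Literature.AlgebraicGeometry.Motives (AbelianVariety)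

variable {A : AbelianVariety ℚ}

/-- **Trivial on `V_ℓ(A)` ⟹ trivial on `A[ℓ]`.**  If `g ∈ Γ_ℚ` acts as the identity on
`V_ℓ(A) = ℚ_ℓ ⊗ T_ℓ(A)` then it fixes every `ℓ`-torsion point of `A(ℚ̄)`: `T_ℓ(A)` is `ℤ_ℓ`-free, so
`x ↦ 1 ⊗ x` is injective and `g` is the identity on `T_ℓ(A)`; and `T_ℓ(A) → A[ℓ]` (first component) is
onto and equivariant. [cite: SerreTate1968, §1] -/
theorem smul_eq_self_of_rationalTateRep_eq_one (ℓ : ℕ) [Fact ℓ.Prime] {g : absoluteGaloisGroup ℚ}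
    (hg : A.rationalTateRep ℓ g = 1) {P : A.geomPoints} (hP : P ∈ A.geomTorsion (ℓ : ℕ)) :
    g • P = P := by
  have hℓ : ((ℓ : ℕ) : ℚ) ≠ 0 := Nat.cast_ne_zero.2 (Fact.out : ℓ.Prime).ne_zero
  -- `g` is the identity on `T_ℓ(A)`
  haveI : Module.Free ℤ_[ℓ] (A.tateModule ℓ) := A.module_free_tateModule_holds ℓ hℓ
  have hinj : Function.Injective fun x : A.tateModule ℓ => ((1 : ℚ_[ℓ]) ⊗ₜ[ℤ_[ℓ]] x) := by
    intro m m' h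
    have hRS : Function.Injective (algebraMap ℤ_[ℓ] ℚ_[ℓ]) := IsFractionRing.injective ℤ_[ℓ] ℚ_[ℓ]
    have hinj' : Function.Injective ((Algebra.linearMap ℤ_[ℓ] ℚ_[ℓ]).rTensor (A.tateModule ℓ)) :=
      Module.Flat.rTensor_preserves_injective_linearMap _ hRS
    have h1 : (Algebra.linearMap ℤ_[ℓ] ℚ_[ℓ]).rTensor (A.tateModule ℓ) ((1 : ℤ_[ℓ]) ⊗ₜ[ℤ_[ℓ]] m) =
        (Algebra.linearMap ℤ_[ℓ] ℚ_[ℓ]).rTensor (A.tateModule ℓ) ((1 : ℤ_[ℓ]) ⊗ₜ[ℤ_[ℓ]] m') := by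
      simpa using h
    simpa using congrArg (TensorProduct.lid ℤ_[ℓ] (A.tateModule ℓ)) (hinj' h1)
  have hT : ∀ x : A.tateModule ℓ, g • x = x := by
    intro x
    apply hinj
    have h1 := congrArg (fun f => f ((1 : ℚ_[ℓ]) ⊗ₜ[ℤ_[ℓ]] x)) hg
    simp only [Literature.AlgebraicGeometry.Motives.AbelianVariety.rationalTateRep,
      rationalTateRepresentation_apply_tmul, Module.End.one_apply] at h1
    exact h1
  -- `T_ℓ(A) → A[ℓ]` is onto (`#A[ℓⁿ] = ℓ^{2 dim A · n}`)
  have hcard : ∀ n, Nat.card ((A.geomPoints)[(ℓ ^ n : ℕ)]) = ℓ ^ (2 * A.dim * n) := fun n =>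
    A.natCard_geomTorsion_pow' ℓ hℓ n
  have hP' : P ∈ (A.geomPoints)[(ℓ ^ 1 : ℕ)] := by simpa using hP
  obtain ⟨x, hx⟩ := proj_surjective_of_card hcard 1 hP'
  rw [← hx, ← proj_smul_of_distribMulAction, hT]

/-- **UNRAM2 from the Euler factor: the torsion representation is unramified at a good prime.**  For
an abelian surface `A/ℚ` (`A.dim = 2`) with a good Euler factor at `p` (`HasGoodEulerFactorAt`,
[BPPTVY (4.1.5)]), a prime `ℓ ≠ p`, and a framed `ρb : Γ_ℚ → GL₄(𝔽_ℓ)` carrying a contragredient torsion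
frame of `A[ℓ]` (`e (g • P) = ρb(g⁻¹)ᵀ e P`; slot TORS3), `ρb` is unramified at every `v ∣ p`: an inertia
element `σ` acts trivially on `V_ℓ(A)` (the frame `[·]_b` is unramified, with local–global bookkeeping
inside `HasGoodEulerFactorAt`), hence on `A[ℓ]` (`smul_eq_self_of_rationalTateRep_eq_one`), so
`ρb(σ)ᵀ` fixes every vector. VERBATIM the slot `hunr` of `modular_of_mod3Row` (`p = 2`, `ℓ = 3`).
[cite: SerreTate1968, §1 Thm. 1] [cite: BoxerCalegariGeePilloni2025, Thm. 1.1.1 (2)] -/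
theorem torsionRep_isUnramifiedAt_of_hasGoodEulerFactorAt (hA : A.dim = 2) {p : ℕ} {L : Polynomial ℚ}
    (hL : A.HasGoodEulerFactorAt p L) {ℓ : ℕ} [Fact ℓ.Prime] (hℓp : ℓ ≠ p)
    (ρb : FramedGaloisRep ℚ (ZMod ℓ) 4)
    (hframe : ∃ e : A.geomTorsion (ℓ : ℕ) ≃+ (Fin 4 → ZMod ℓ),
      ∀ (g : absoluteGaloisGroup ℚ) (P : A.geomTorsion (ℓ : ℕ)),
        e (g • P) = ((ρb g⁻¹ : GL (Fin 4) (ZMod ℓ)) : Matrix (Fin 4) (Fin 4) (ZMod ℓ)).transpose.mulVec (e P)) :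
    ∀ v : HeightOneSpectrum (𝓞 ℚ), ((p : ℕ) : 𝓞 ℚ) ∈ v.asIdeal → ρb.IsUnramifiedAt v := by
  intro v hv 𝔓 h𝔓 σ hσ
  obtain ⟨e, he⟩ := hframe
  obtain ⟨b, r₀, hfr⟩ := exists_isFrameOfTateRep hA ℓ
  -- the frame of `V_ℓ(A)` is unramified at `v`: `σ⁻¹` acts trivially on `V_ℓ(A)`
  have h1 : r₀ σ⁻¹ = 1 := (hL ℓ hℓp b r₀ hfr v hv).1 𝔓 h𝔓 σ⁻¹ (inv_mem hσ)
  have hV : A.rationalTateRep ℓ σ⁻¹ = 1 := by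
    have h2 := congrArg (fun u : GL (Fin 4) ℚ_[ℓ] => (u : Matrix (Fin 4) (Fin 4) ℚ_[ℓ])) h1
    simp only [Units.val_one] at h2
    rw [hfr] at h2
    exact (LinearMap.toMatrix b b).injective (by rw [h2, LinearMap.toMatrix_one])
  -- hence on `A[ℓ]`, so `ρb(σ)ᵀ` fixes every vector of `(ℤ/ℓ)⁴`
  have hfix : ∀ x : Fin 4 → ZMod ℓ,
      ((ρb σ : GL (Fin 4) (ZMod ℓ)) : Matrix (Fin 4) (Fin 4) (ZMod ℓ)).transpose.mulVec x = x := by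
    intro x
    obtain ⟨P, rfl⟩ := e.surjective x
    have hP : σ⁻¹ • P = P := Subtype.ext (by
      rw [AddSubgroup.torsionBy.coe_smul]
      exact smul_eq_self_of_rationalTateRep_eq_one ℓ hV P.2)
    have h3 := he σ⁻¹ P
    rw [inv_inv, hP] at h3
    exact h3.symm
  apply Units.ext
  have h4 : Matrix.toLin' ((ρb σ : GL (Fin 4) (ZMod ℓ)) : Matrix (Fin 4) (Fin 4) (ZMod ℓ)).transpose =
      Matrix.toLin' (1 : Matrix (Fin 4) (Fin 4) (ZMod ℓ)) := by
    refine LinearMap.ext fun x => ?_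
    rw [Matrix.toLin'_apply, Matrix.toLin'_apply, hfix, Matrix.one_mulVec]
  have h5 := Matrix.toLin'.injective h4
  rw [Units.val_one, ← Matrix.transpose_one, ← h5, Matrix.transpose_transpose]

end Summit.Ventures.ResidMod

end
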